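import Summits.CriticalPhenomena.PercolationContinuityZ3.Theorems.PercNearOneGluingNoHeavyLowerTailMajorityGluingQCertSort
import Summits.CriticalPhenomena.PercolationContinuityZ3.Theorems.PercNearOneGluingNoHeavyLowerTailMajorityGluingQCertSound
import HarnessLib

/-!
# Degree-3 certificates for the cut-pattern laws: the cubic language, its expansion into contributions, and the kernel check (lane prim-rate, constants-miner 1, gen 34; NEXT-g35 item 1)

Support file for the closed crux `NoHeavyLowerTail` (stmt-CriticalPhenomena-4575), majority-gluing line.  One Sherali–Adams lift of the degree-2 language of
`…MajorityGluingQCert` (every generator multiplied by one more variable; the multiplier of the conclusion becomes a quadratic form) breaks the `5/4` floor of the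
degree-2 certificates at the cell `(6,4)` (kit j269592: `c = 1.22` feasible).  THE CUBIC LANGUAGE (`Cert3`, over a `base : Cert` carrying `m, h, cN, cD, fam`):
`n·(cN·x_D − cD·T)·x_a x_b` (`ell2`), `n·(x_D − m_x)·x_a x_b` and `n·(E_{x+1} − E_x)·x_a x_b` (`lin3`, kinds `1`/`2`), `n·(f₃f₄ − f₁f₂)·x_t` (`rows`: a van den Berg–Kahn row of
the base language times a variable), `n·(a f₁ − b f₂)²·x_t` (`sqs`).  Every entry EXPANDS (`Cert3.contribs`) into contributions `(key of the cubic monomial, ± n·coefficient)`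
(`key3` sorts the index triple and encodes it in base `NV`); the check `Cert3.checkQ3 fuel` sorts all contributions (`msortK`, `…QCertSort`) and scans the runs (`runsOK`), and
`Cert3.checkW3` is the structural part (indices in range, `cD > 0`, `h ≥ 1`, positive `δ²`-weight of `ell2`, rows' masks = cylinders).  The value of the contribution list at the
valuation `key ↦ v·v·v` is `Λ(v)·ℓ₂(v) − (lin3) − (rows) − (squares)` (`evalC_contribs`); soundness (`…QCert3Sound`) follows as in degree 2.  No sorries.
-/

namespace Summit.CriticalPhenomena.PercolationContinuityZ3.Theorems

namespace HubOnly
namespace QCert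

/-! ### The cubic language -/

/-- A degree-2 row of the base language times the variable `x_t`. -/
structure RowE3 where
  /-- the van den Berg–Kahn row (sets, multiplier, masks) -/
  row : RowE
  /-- the lift variable -/
  t : ℕ

/-- A square of the base language times the variable `x_t`. -/
structure SqE3 where
  /-- the square `(a f₁ − b f₂)²` (multiplier, masks) -/
  sq : SqE
  /-- the lift variable -/
  t : ℕ

/-- A degree-3 certificate: the parameters of a base certificate (its own entry lists are ignored) and the cubic entries. -/
structure Cert3 where
  /-- `m, h, cN, cD, fam` (the lists of `base` play no role) -/
  base : Cert
  /-- `(a, b, n)`: `n·(cN·x_D − cD·T)·x_a·x_b` — the quadratic multiplier `ℓ₂` of the conclusion -/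
  ell2 : List (ℕ × ℕ × ℕ)
  /-- `(kind, x, a, b, n)`: kind `1`: `n·(x_D − m_x)·x_a x_b`; kind `2`: `n·(E_{x+1} − E_x)·x_a x_b` -/
  lin3 : List (ℕ × ℕ × ℕ × ℕ × ℕ)
  /-- rows times variables, chunked -/
  rows : List (List RowE3)
  /-- squares times variables, chunked -/
  sqs : List (List SqE3)

/-! ### Keys of cubic monomials -/

/-- The sorted triple of three indices. -/
def sort3 (i j k : ℕ) : ℕ × ℕ × ℕ :=
  if i ≤ j then (if j ≤ k then (i, j, k) else if i ≤ k then (i, k, j) else (k, i, j))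
  else (if i ≤ k then (j, i, k) else if j ≤ k then (j, k, i) else (k, j, i))

/-- Base-`N` code of a triple. -/
def enc3 (N : ℕ) (p : ℕ × ℕ × ℕ) : ℕ := p.2.2 + N * (p.2.1 + N * p.1)

/-- The key of the cubic monomial `x_i x_j x_k`. -/
def key3 (N i j k : ℕ) : ℕ := enc3 N (sort3 i j k)

/-! ### Expansion into contributions -/

/-- The indices `< N` selected by a Boolean form. -/
def suppOf (N : ℕ) (P : ℕ → Bool) : List ℕ := (List.range N).filter P

namespace Cert3

variable (c : Cert3)

/-- Number of variables (of the base language). -/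
abbrev NV : ℕ := c.base.NV

/-- Contributions of an `ell2` entry (LHS, positive): `n·cN` at `x_D x_a x_b`, `−n·cD` at `x_i x_a x_b` for `i ∈ T`. -/
def ell2C (e : ℕ × ℕ × ℕ) : List (ℕ × ℤ) :=
  (key3 c.NV c.base.D e.1 e.2.1, (e.2.2 : ℤ) * c.base.cN) ::
    (suppOf c.NV c.base.tMem).map fun i => (key3 c.NV i e.1 e.2.1, -((e.2.2 : ℤ) * c.base.cD))

/-- Contributions of a `lin3` entry (RHS, entered negated): kind `1`: `−n` at `x_D x_a x_b`, `+n` at `x_i x_a x_b` for `i ∋ x`; kind `2`: `−n` on `E_{x+1}`, `+n` on `E_x`. -/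
def lin3C (e : ℕ × ℕ × ℕ × ℕ × ℕ) : List (ℕ × ℤ) :=
  if e.1 = 1 then
    (key3 c.NV c.base.D e.2.2.1 e.2.2.2.1, -(e.2.2.2.2 : ℤ)) ::
      (suppOf c.NV (c.base.margMem e.2.1)).map fun i => (key3 c.NV i e.2.2.1 e.2.2.2.1, (e.2.2.2.2 : ℤ))
  else
    ((suppOf c.NV (c.base.eMem (e.2.1 + 1))).map fun i => (key3 c.NV i e.2.2.1 e.2.2.2.1, -(e.2.2.2.2 : ℤ))) ++
      (suppOf c.NV (c.base.eMem e.2.1)).map fun i => (key3 c.NV i e.2.2.1 e.2.2.2.1, (e.2.2.2.2 : ℤ))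

/-- Contributions of the product of two mask forms times `x_t`, with coefficient `z`. -/
def prodC (N m1 m2 t : ℕ) (z : ℤ) : List (ℕ × ℤ) :=
  ((suppOf N (tb m1)).map fun i => (suppOf N (tb m2)).map fun j => (key3 N i j t, z)).flatten

/-- Contributions of a row entry (RHS, negated): `−n` on `f₃⊗f₄·x_t`, `+n` on `f₁⊗f₂·x_t`. -/
def row3C (r : RowE3) : List (ℕ × ℤ) :=
  prodC c.NV r.row.m3 r.row.m4 r.t (-(r.row.n : ℤ)) ++ prodC c.NV r.row.m1 r.row.m2 r.t (r.row.n : ℤ)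

/-- Contributions of a square entry (RHS, negated): `−n·u_i·u_j` at `x_i x_j x_t` over the support of `u`. -/
def sq3C (s : SqE3) : List (ℕ × ℤ) :=
  ((suppOf c.NV (tb (s.sq.m1 ||| s.sq.m2))).map fun i =>
    (suppOf c.NV (tb (s.sq.m1 ||| s.sq.m2))).map fun j => (key3 c.NV i j s.t, -((s.sq.n : ℤ) * s.sq.u i * s.sq.u j))).flatten

/-- **All contributions of the certificate** (LHS positive, RHS negative). -/
def contribs : List (ℕ × ℤ) :=
  (c.ell2.map c.ell2C).flatten ++ (c.lin3.map c.lin3C).flatten ++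
    (c.rows.map fun ch => (ch.map c.row3C).flatten).flatten ++ (c.sqs.map fun ch => (ch.map c.sq3C).flatten).flatten

/-! ### The checks -/

/-- The `δ²`-weight of `ℓ₂`. -/
def ell2DD : ℕ := (c.ell2.map fun e => if e.1 = c.base.D ∧ e.2.1 = c.base.D then e.2.2 else 0).sum

/-- **The structural check**: `cD > 0`, `h ≥ 1`, `ℓ₂` has a `δ²` term, all indices `< NV`, kinds and relay indices in range, rows well formed. -/
def checkW3 : Bool :=
  decide (0 < c.base.cD) && decide (1 ≤ c.base.h) && decide (0 < c.ell2DD) &&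
    c.ell2.all (fun e => decide (e.1 < c.NV) && decide (e.2.1 < c.NV)) &&
    c.lin3.all (fun e => (decide (e.1 = 1) && decide (e.2.1 < c.base.m) || decide (e.1 = 2) && decide (e.2.1 + 1 < c.base.m)) &&
      decide (e.2.2.1 < c.NV) && decide (e.2.2.2.1 < c.NV)) &&
    c.rows.all (fun ch => ch.all fun r => c.base.rowOK r.row && decide (r.t < c.NV)) &&
    c.sqs.all (fun ch => ch.all fun s => decide (s.t < c.NV))

/-- **The cubic check**: sort all contributions by key and scan the runs. -/
def checkQ3 (fuel : ℕ) : Bool := runsOK (msortK fuel c.contribs)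

/-- **The full degree-3 check.** -/
def check3 (fuel : ℕ) : Bool := c.checkW3 && c.checkQ3 fuel

end Cert3

end QCert
end HubOnly

end Summit.CriticalPhenomena.PercolationContinuityZ3.Theorems
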